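import Literature.NumberTheory.DiophantineGeometry.FaltingsHeightIsogenyLocalPartProofs
import Literature.NumberTheory.EllipticCurves.IsogenyPeriodLatticeProofs
import Literature.NumberTheory.EllipticCurves.DeltaQuotientIntegralProofs
import Mathlib.LinearAlgebra.FreeModule.PID
import Mathlib.RingTheory.Valuation.LocalSubring
import Mathlib.RingTheory.DedekindDomain.AdicValuation
import HarnessLib

/-!
# Faltings' isogeny inequality for elliptic curves: the finite part, and the proof of the named fact

Topic `NumberTheory/DiophantineGeometry`; a proofs-only file (theorems only: no definitions, no
named facts).  It discharges the named fact

  `WeierstrassCurve.stableFaltingsHeight_le_of_isogeny` :  `h_F(E') ≤ h_F(E) + ½ log deg φ`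

(`FaltingsHeight.lean`; Faltings 1983, §3 Lemma 5, recalled in Gaudron–Rémond 2014, §2.3:
"si `φ : A → A'` est une isogénie alors `h(A') ≤ h(A) + ½ log deg φ`") for every isogeny
`φ : E → E'` of elliptic curves over a number field, by proving the per-prime statement (D_v) left
open by `FaltingsHeightIsogenyLocalPartProofs.lean`:

  for short models `E, E'` over `K`, `ψ : E → E'` with multiplier `α₀` (`ψ^*ω' = α₀ω`) and every
  maximal ideal `v` of `𝓞_K`:  `max(0, −ord_v j(E')) ≤ max(0, −ord_v j(E)) + ord_v(Δ_{E'}α₀¹²/Δ_E)`.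

This is the finite-place term `[K:ℚ]⁻¹ log #s^*Ω¹_{G/R} ≥ 0` of Faltings' proof ("`φ^*` is integral
on Néron differentials").  Instead of Néron models we use the transcendental description of the
multiplier and the arithmetic of `Δ` and `j` on the isogeny class (Lang, *Elliptic Functions*,
Ch. 12 §2, Thm. 2–4; Deuring), through the integrality theorems of
`DeltaQuotientIntegralProofs.lean`.

## Part I — `Δ(L)/Δ(M)` and `g₂(L)³/g₂(M)³` for a sublattice `M ⊆ L`, at a valuation subring of `ℂ`

(`namespace PeriodPair`, dot-notation extensions of Mathlib's `PeriodPair`.)  For complex lattices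
`M ⊆ L` write `Δ(Λ) = g₂(Λ)³ − 27g₃(Λ)²`, `j(Λ) = 1728 g₂³/Δ`.

* `PeriodPair.valuationSubring_dichotomy_of_le` — if `M.lattice ≤ L.lattice` then for every
  valuation subring `B ⊆ ℂ`: `j(L) ∈ B ⟹ j(M) ∈ B ∧ Δ(L)/Δ(M) ∈ B` and
  `j(L) ∉ B ⟹ j(M) ∉ B ∧ g₂(L)³/g₂(M)³ ∈ B`.

Proof.  (1) *Prime index in Hermite form* (`valuationSubring_dichotomy_of_heckeData`): for
`L = c(ℤτ + ℤ)` and `M = c(ℤpτ + ℤ)` or `M = c(ℤ(τ + k) + ℤp)`, `j(L) = j(τ)`, `j(M) = j(pτ)` resp.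
`j((τ + k)/p)`, `Δ(L)/Δ(M) = Δ(τ)/Δ(pτ)` resp. `p¹²Δ(τ)/Δ((τ+k)/p)` are integral over `ℤ[j(τ)]`
(the modular equation and `exists_intPoly_deltaQuotient`), `j(τ)` is integral over `ℤ[j(M)]`, and a
valuation ring is integrally closed; for `j(L) ∉ B`, `z = 1/j(τ)` lies in the maximal ideal of `B` and
the monic `X^{p+1} + Σ_{m ≥ 1} (−1)^m B_m(j)z^{p+1−m}/(B_0(j)z^{p+1}) X^{p+1−m} ∈ B[X]`
(`exists_intPolys_deltaQuotient_mul_X_add_jConj`: `deg B_m ≤ p + 1 − m`, `B_0 = ±X^{p+1} + ⋯`, so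
`B_0(j)z^{p+1} ∈ ±1 + zB` is a unit) kills `g₂(L)³/g₂(M)³ = w·j(τ)/j(M)`.  (2) The dichotomy only
depends on the lattices and is *transitive* along `M ⊆ K ⊆ L`.  (3) *Stacked bases* (Smith normal
form over `ℤ`, Mathlib `Submodule.exists_smith_normal_form_of_rank_eq`): `L = ℤB₁ ⊕ ℤB₂`,
`M = ℤn₁B₁ ⊕ ℤn₂B₂`, refined prime by prime (`ℤpmB₁ ⊕ ℤB₂ ⊆ ℤmB₁ ⊕ ℤB₂` is in Hermite form with
`τ = mB₁/B₂` or `τ = B₂/(mB₁)`), so that no index is ever computed.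

## Part II — the finite part (D_v) and the named fact

1. **The multiplier is unique** (`Isogeny.multiplier_unique`): the coordinate identity
   `α₀ · 2P₂Q₁² = (δP₁·Q₁ − P₁·δQ₁)·Q₂` at a good point forces `α₀`, so `α₀` is the multiplier of
   `IsogenyPeriodLatticeProofs`: at a complex embedding `σ`, `σ(α₀)Λ_E ⊆ Λ_{E'}` for the Néron
   lattices (`Isogeny.exists_multiplier_of_isShort`).
2. **`ord_v` through a valuation subring of `ℂ`** (`exists_valuationSubring_map_mem_iff`): the local
   ring `𝓞_{K,v} ⊆ K` maps into `ℂ` by `σ`, and Chevalley's extension theorem (Mathlib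
   `IsLocalRing.exists_factor_valuationRing`) gives a valuation subring `A ⊆ ℂ` with
   `σ(y) ∈ A ⟺ |y|_v ≤ 1 ⟺ ord_v(y) ≥ 0` for all `y ∈ Kˣ` (`valuation_eq_exp_neg_count`).
3. **The dichotomy** for `σ(α₀)Λ_E ⊆ Λ_{E'}` and `A`: with
   `μ = Δ_{E'}α₀¹²/Δ_E = Δ(Λ_{E'})/Δ(σ(α₀)Λ_E)` and `ν = c₄(E')³α₀¹²/c₄(E)³ = g₂(Λ_{E'})³/g₂(σ(α₀)Λ_E)³`:
   if `ord_v j(E') ≥ 0` then `ord_v μ ≥ 0`; otherwise `ord_v j(E) < 0` and `ord_v ν ≥ 0`, i.e.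
   `ord_v μ ≥ ord_v j(E) − ord_v j(E')`.  Either way (D_v) follows.

* `WeierstrassCurve.stableFaltingsHeight_le_of_isogeny_holds : stableFaltingsHeight_le_of_isogeny`.

## Mathlib / tree search

Tree: `PeriodPair.j`, `j_mulLeft`, `discr_mulLeft`, `g₂_mulLeft`, `g₂/j/discr_ofUpperHalfPlane`,
`g₂_eq_of_lattice_eq`, `kleinJ_eq_periodPair_j`, `j_eq_weierstrassCurve_j` (`LatticeJInvariant`,
`Uniformization*`, `RealLatticePeriod`, `ModularCurveKleinJ`); `intModularPolynomial_kleinJ_mulPoint/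
divPoint`, `monic_intModularPolynomial` (`ModularPolynomialIntegral`); `exists_intPoly_deltaQuotient`,
`exists_intPolys_deltaQuotient_mul_X_add_jConj` (`DeltaQuotientIntegralProofs`);
`Isogeny.exists_multiplier_of_isShort` (`IsogenyPeriodLatticeProofs`);
`stableFaltingsHeight_le_of_isogeny_of_localPart` (`FaltingsHeightIsogenyLocalPartProofs`).  Mathlib:
`ValuationSubring` (integrally closed, local, `mem_or_inv_mem`), `valuationSubringAtPrime`,
`IsLocalRing.exists_factor_valuationRing`, `Polynomial.lifts_and_degree_eq_and_monic`,
`IsIntegrallyClosed.isIntegral_iff`, `Submodule.exists_smith_normal_form_of_rank_eq`, `ZLattice.rank`,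
`Nat.recOnMul`, `FractionalIdeal.count_mul/inv/coe`, `HeightOneSpectrum.intValuation_if_neg`.

## References

* [Faltings1986FinitenessTranslation] G. Faltings, *Finiteness theorems for abelian varieties over
  number fields*, in Cornell–Silverman, *Arithmetic Geometry*, Ch. II, §3, Lemma 5 and its proof.
* [GaudronRemondPeriodes2014] É. Gaudron, G. Rémond, *Théorème des périodes et degrés minimaux
  d'isogénies*, Comment. Math. Helv. 89 (2014), §2.3.
* [Lang1987] S. Lang, *Elliptic Functions*, 2nd ed., GTM 112, Springer 1987, Ch. 12 §2, Thm. 2–4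
  (PDF pp. 124–125 of the held copy).
* [Cox2013] D. A. Cox, *Primes of the form x² + ny²*, 2nd ed., Wiley 2013, §11.C Thm. 11.18 (i).
* [SilvermanAEC2009] J. H. Silverman, *The Arithmetic of Elliptic Curves*, 2nd ed., III.1, III.5,
  VI.4.1, VI.5.
-/

noncomputable section

section SublatticeDichotomy

open Polynomial
open UpperHalfPlane hiding I
open scoped Real

namespace PeriodPair

open Literature.NumberTheory.EllipticCurves Literature.NumberTheory.EllipticCurves.ModularForms

/-! ### Valuation subrings of a field: integrally closed, local -/

/-- An element integral over a valuation subring `B` of a field lies in `B` (valuation rings are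
integrally closed, Mathlib). [folklore] -/
theorem mem_valuationSubring_of_isIntegral {F : Type*} [Field F] {B : ValuationSubring F} {x : F}
    (hx : IsIntegral B x) : x ∈ B := by
  obtain ⟨y, hy⟩ := (IsIntegrallyClosed.isIntegral_iff (R := B) (K := F)).mp hx
  rw [← hy]
  exact y.2

/-- A root of a monic polynomial with coefficients in a valuation subring `B` lies in `B`. [folklore] -/
theorem mem_valuationSubring_of_monic_of_eval_eq_zero {F : Type*} [Field F] {B : ValuationSubring F}
    {P : Polynomial F} (hP : P.Monic) (hcoeff : ∀ n, P.coeff n ∈ B) {x : F} (hx : P.eval x = 0) : x ∈ B := by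
  have hlifts : P ∈ Polynomial.lifts (algebraMap B F) := by
    rw [Polynomial.lifts_iff_coeff_lifts]
    intro n
    exact ⟨⟨P.coeff n, hcoeff n⟩, rfl⟩
  obtain ⟨q, hq, -, hqm⟩ := Polynomial.lifts_and_degree_eq_and_monic hlifts hP
  refine mem_valuationSubring_of_isIntegral ⟨q, hqm, ?_⟩
  rw [← Polynomial.eval_map, hq, hx]

/-- The value at `y ∈ B` of an integer polynomial lies in `B`. [folklore] -/
theorem eval_map_intCast_mem {F : Type*} [Field F] {B : ValuationSubring F} (q : Polynomial ℤ) {y : F}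
    (hy : y ∈ B) : (q.map (Int.castRingHom F)).eval y ∈ B := by
  have h : (q.map (Int.castRingHom F)).eval y =
      algebraMap B F ((q.map (Int.castRingHom B)).eval ⟨y, hy⟩) := by
    rw [Polynomial.eval_map, Polynomial.eval_map, Polynomial.hom_eval₂,
      RingHom.eq_intCast' ((algebraMap B F).comp (Int.castRingHom B))]
    rfl
  rw [h]
  exact Subtype.mem _

/-- **Roots of a monic `Φ ∈ ℤ[Y][X]` over `y ∈ B` lie in `B`**: if `Φ(x, y) = 0` with `Φ` monic in
`X` and `y` in the valuation subring `B`, then `x ∈ B`. [folklore] -/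
theorem mem_valuationSubring_of_intPoly {F : Type*} [Field F] {B : ValuationSubring F}
    {Φ : Polynomial (Polynomial ℤ)} (hΦ : Φ.Monic) {x y : F} (hy : y ∈ B)
    (h : ((Φ.map (mapRingHom (Int.castRingHom F))).map (evalRingHom y)).eval x = 0) : x ∈ B := by
  refine mem_valuationSubring_of_monic_of_eval_eq_zero ((hΦ.map _).map _) (fun n ↦ ?_) h
  rw [Polynomial.coeff_map, Polynomial.coeff_map, coe_evalRingHom, coe_mapRingHom]
  exact eval_map_intCast_mem _ hy

/-- If `y ∉ B` then `y ≠ 0` and `y⁻¹` is a non-unit of `B` (i.e. lies in its maximal ideal). [folklore] -/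
theorem inv_mem_nonunits_of_not_mem {F : Type*} [Field F] {B : ValuationSubring F} {y : F} (hy : y ∉ B) :
    y ≠ 0 ∧ ∃ hz : y⁻¹ ∈ B, (⟨y⁻¹, hz⟩ : B) ∈ nonunits B := by
  have hy0 : y ≠ 0 := by
    rintro rfl
    exact hy (zero_mem B)
  have hz : y⁻¹ ∈ B := (B.mem_or_inv_mem y).resolve_left hy
  refine ⟨hy0, hz, fun hu ↦ hy ?_⟩
  obtain ⟨u, hu⟩ := hu
  have h1 : ((u⁻¹ : Bˣ) : B) * ⟨y⁻¹, hz⟩ = 1 := by rw [← hu, Units.inv_mul]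
  have h2 : (((u⁻¹ : Bˣ) : B) : F) * y⁻¹ = 1 := by
    have := congr_arg (fun b : B ↦ (b : F)) h1
    simpa using this
  have h3 : (((u⁻¹ : Bˣ) : B) : F) = y := by
    field_simp at h2
    linear_combination h2
  rw [← h3]
  exact Subtype.mem _


/-! ### Lattices in Hermite form: `L = c(ℤτ + ℤ)`, `M = c(ℤpτ + ℤ)` or `c(ℤ(τ + k) + ℤp)` -/

section Hecke

variable {p : ℕ} [Fact p.Prime]

/-- `Δ(c Λ_τ) = c⁻¹² (2π)¹² Δ(τ)`. [folklore] -/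
theorem discr_mulLeft_ofUpperHalfPlane (c : ℂ) (hc : c ≠ 0) (τ : ℍ) :
    ((ofUpperHalfPlane τ).mulLeft c hc).g₂ ^ 3 - 27 * ((ofUpperHalfPlane τ).mulLeft c hc).g₃ ^ 2 =
      (c ^ 12)⁻¹ * ((2 * (π : ℂ)) ^ 12 * ModularForm.discriminant τ) := by
  rw [discr_mulLeft, discr_ofUpperHalfPlane]

/-- `g₂(c Λ_τ) = c⁻⁴ (4π⁴/3) E₄(τ)`. [folklore] -/
theorem g₂_mulLeft_ofUpperHalfPlane (c : ℂ) (hc : c ≠ 0) (τ : ℍ) :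
    ((ofUpperHalfPlane τ).mulLeft c hc).g₂ = (c ^ 4)⁻¹ * ((4 * (π : ℂ) ^ 4 / 3) * ModularForm.E₄ τ) := by
  rw [g₂_mulLeft, g₂_ofUpperHalfPlane]

/-- `j(c Λ_τ) = j(τ)`. [folklore] -/
theorem j_mulLeft_ofUpperHalfPlane (c : ℂ) (hc : c ≠ 0) (τ : ℍ) :
    ((ofUpperHalfPlane τ).mulLeft c hc).j = kleinJ τ := by
  rw [j_mulLeft, kleinJ_eq_periodPair_j]

/-- `p(τ/p·... )`: the point `(pτ + 0)/p` is `τ`. [folklore] -/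
theorem divPoint_zero_mulPoint (τ : ℍ) : divPoint p 0 (mulPoint p τ) = τ := by
  apply UpperHalfPlane.ext
  rw [coe_divPoint, coe_mulPoint, Int.cast_zero, add_zero, mul_div_cancel_left₀ _ modularLevel_ne_zero]

/-- `p · (τ + k)/p = T^k τ`. [folklore] -/
theorem mulPoint_divPoint (k : ℤ) (τ : ℍ) : mulPoint p (divPoint p k τ) = ModularGroup.T ^ k • τ := by
  apply UpperHalfPlane.ext
  rw [coe_mulPoint, coe_divPoint, UpperHalfPlane.modular_T_zpow_smul, UpperHalfPlane.coe_vadd,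
    mul_div_cancel₀ _ modularLevel_ne_zero]
  push_cast
  ring

/-- **`j(τ)` is integral over `ℤ[j(pτ)]` and over `ℤ[j((τ + k)/p)]`**: `Φ_p(j(τ), j(σ_i τ)) = 0`
(the lattice `ℤτ + ℤ` is itself one of the `p + 1` lattices of index `p` in `p⁻¹ M_i`).
[cite: Cox2013, §11.B (11.15)] -/
theorem intModularPolynomial_kleinJ_of_jConj (i : Option (ZMod p)) (τ : ℍ) :
    (((intModularPolynomial p).map (mapRingHom (Int.castRingHom ℂ))).map
      (evalRingHom (jConj i τ))).eval (kleinJ τ) = 0 := by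
  cases i with
  | none =>
    rw [jConj_none]
    have h := intModularPolynomial_kleinJ_divPoint p 0 (mulPoint p τ)
    rwa [divPoint_zero_mulPoint] at h
  | some k =>
    rw [jConj_some]
    have h := intModularPolynomial_kleinJ_mulPoint p (divPoint p (k.val : ℤ) τ)
    rwa [mulPoint_divPoint, kleinJ_smul] at h

/-- `j(σ_i τ)` is a root of `Φ_p(X, j(τ))`. [cite: Cox2013, §11.B (11.15)] -/
theorem intModularPolynomial_jConj (i : Option (ZMod p)) (τ : ℍ) :
    (((intModularPolynomial p).map (mapRingHom (Int.castRingHom ℂ))).map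
      (evalRingHom (kleinJ τ))).eval (jConj i τ) = 0 := by
  cases i with
  | none => rw [jConj_none]; exact intModularPolynomial_kleinJ_mulPoint p τ
  | some k => rw [jConj_some]; exact intModularPolynomial_kleinJ_divPoint p _ τ

/-- **The prime step in Hermite form.**  Let `L, M` be period pairs with `L.lattice = c(ℤτ + ℤ)` and
`M.lattice = c(ℤpτ + ℤ)` (`i = ∞`) or `M.lattice = cp(ℤ(τ + k)/p + ℤ) = c(ℤ(τ + k) + ℤp)`
(`i = k`).  Then for every valuation subring `B ⊆ ℂ`:
`j(L) ∈ B ⟹ j(M) ∈ B ∧ Δ(L)/Δ(M) ∈ B` (the modular equation and Lang's Thm. 12.2.2: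
`j(M) = j(σ_iτ)` and `Δ(L)/Δ(M) = w_i(τ)` are integral over `ℤ[j(τ)] ⊆ B`), and
`j(L) ∉ B ⟹ j(M) ∉ B ∧ g₂(L)³/g₂(M)³ ∈ B` (`j(τ)` is integral over `ℤ[j(σ_iτ)]`; and with
`z = 1/j(τ)` in the maximal ideal of `B`, `g₂(L)³/g₂(M)³ = w_i j(τ)/j(σ_iτ)` is a root of the monic
`X^{p+1} + Σ_{m≥1} (−1)^m B_m(j)z^{p+1−m}/(B_0(j)z^{p+1}) X^{p+1−m} ∈ B[X]`).
[cite: Lang1987, Ch. 12 §2 Thm. 2–4 (PDF pp. 124–125); Cox2013, §11.C Thm. 11.18(i)] -/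
theorem valuationSubring_dichotomy_of_heckeData {M L : PeriodPair} {τ : ℍ} {c : ℂ} {hc : c ≠ 0}
    (hL : L.lattice = ((ofUpperHalfPlane τ).mulLeft c hc).lattice) (i : Option (ZMod p))
    (hM : M.lattice = Option.elim i (((ofUpperHalfPlane (mulPoint p τ)).mulLeft c hc).lattice)
      (fun k ↦ ((ofUpperHalfPlane (divPoint p (k.val : ℤ) τ)).mulLeft (c * p)
        (mul_ne_zero hc modularLevel_ne_zero)).lattice))
    (B : ValuationSubring ℂ) :
    (L.j ∈ B → M.j ∈ B ∧ (L.g₂ ^ 3 - 27 * L.g₃ ^ 2) / (M.g₂ ^ 3 - 27 * M.g₃ ^ 2) ∈ B) ∧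
    (L.j ∉ B → M.j ∉ B ∧ L.g₂ ^ 3 / M.g₂ ^ 3 ∈ B) := by
  classical
  have hp := (Fact.out : p.Prime)
  have hπ : (π : ℂ) ≠ 0 := Complex.ofReal_ne_zero.mpr Real.pi_ne_zero
  have hpC : (p : ℂ) ≠ 0 := modularLevel_ne_zero
  -- the invariants of `L` and `M`
  have hLj : L.j = kleinJ τ := by rw [j_eq_of_lattice_eq hL, j_mulLeft_ofUpperHalfPlane]
  have hLΔ : L.g₂ ^ 3 - 27 * L.g₃ ^ 2 = (c ^ 12)⁻¹ * ((2 * (π : ℂ)) ^ 12 * ModularForm.discriminant τ) := by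
    rw [g₂_eq_of_lattice_eq hL, g₃_eq_of_lattice_eq hL, discr_mulLeft_ofUpperHalfPlane]
  have hLg₂ : L.g₂ = (c ^ 4)⁻¹ * ((4 * (π : ℂ) ^ 4 / 3) * ModularForm.E₄ τ) := by
    rw [g₂_eq_of_lattice_eq hL, g₂_mulLeft_ofUpperHalfPlane]
  -- `w = Δ(L)/Δ(M)`, `j(M) = j(σ_i τ)`, `ν = g₂(L)³/g₂(M)³ = w j(τ)/j(σ_iτ)`
  generalize hw_def : (L.g₂ ^ 3 - 27 * L.g₃ ^ 2) / (M.g₂ ^ 3 - 27 * M.g₃ ^ 2) = w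
  have hMj : M.j = jConj i τ := by
    cases i with
    | none => simp only [Option.elim_none] at hM; rw [j_eq_of_lattice_eq hM, j_mulLeft_ofUpperHalfPlane, jConj_none]
    | some k => simp only [Option.elim_some] at hM; rw [j_eq_of_lattice_eq hM, j_mulLeft_ofUpperHalfPlane, jConj_some]
  have hw : w = Option.elim i (ModularForm.discriminant τ / ModularForm.discriminant (mulPoint p τ))
      (fun k ↦ (p : ℂ) ^ 12 * ModularForm.discriminant τ / ModularForm.discriminant (divPoint p (k.val : ℤ) τ)) := by
    rw [← hw_def, hLΔ]
    cases i with
    | none =>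
      simp only [Option.elim_none] at hM ⊢
      rw [g₂_eq_of_lattice_eq hM, g₃_eq_of_lattice_eq hM, discr_mulLeft_ofUpperHalfPlane]
      have hΔ := ModularForm.discriminant_ne_zero (mulPoint p τ)
      field_simp
    | some k =>
      simp only [Option.elim_some] at hM ⊢
      rw [g₂_eq_of_lattice_eq hM, g₃_eq_of_lattice_eq hM, discr_mulLeft_ofUpperHalfPlane]
      have hΔ := ModularForm.discriminant_ne_zero (divPoint p (k.val : ℤ) τ)
      field_simp
  have hν : L.g₂ ^ 3 / M.g₂ ^ 3 = w * kleinJ τ / jConj i τ := by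
    rw [hw, hLg₂]
    cases i with
    | none =>
      simp only [Option.elim_none] at hM ⊢
      rw [g₂_eq_of_lattice_eq hM, g₂_mulLeft_ofUpperHalfPlane, jConj_none, kleinJ, kleinJ]
      have hΔ := ModularForm.discriminant_ne_zero (mulPoint p τ)
      have hΔ' := ModularForm.discriminant_ne_zero τ
      by_cases hE : ModularForm.E₄ (mulPoint p τ) = 0
      · rw [hE]; simp
      · field_simp
    | some k =>
      simp only [Option.elim_some] at hM ⊢
      rw [g₂_eq_of_lattice_eq hM, g₂_mulLeft_ofUpperHalfPlane, jConj_some, kleinJ, kleinJ]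
      have hΔ := ModularForm.discriminant_ne_zero (divPoint p (k.val : ℤ) τ)
      have hΔ' := ModularForm.discriminant_ne_zero τ
      by_cases hE : ModularForm.E₄ (divPoint p (k.val : ℤ) τ) = 0
      · rw [hE]; simp
      · field_simp
  have hw0 : w ≠ 0 := by
    rw [← hw_def]; exact div_ne_zero L.discr_ne_zero M.discr_ne_zero
  refine ⟨fun hjB ↦ ⟨?_, ?_⟩, fun hjB ↦ ?_⟩
  · -- `j(M) = j(σ_iτ)` is a root of `Φ_p(X, j(τ))`
    rw [hMj]
    rw [hLj] at hjB
    exact mem_valuationSubring_of_intPoly (monic_intModularPolynomial p) hjB (intModularPolynomial_jConj i τ)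
  · -- `w = w_i(τ)` is a root of Lang's polynomial `Φ^Δ(X, j(τ))`
    rw [hLj] at hjB
    obtain ⟨Φ, hΦm, -, hΦ⟩ := exists_intPoly_deltaQuotient (p := p)
    refine mem_valuationSubring_of_intPoly hΦm hjB ?_
    rw [hΦ τ, eval_mul, eval_prod, hw]
    cases i with
    | none => simp only [Option.elim_none, eval_sub, eval_X, eval_C, sub_self, zero_mul]
    | some k =>
      simp only [Option.elim_some]
      rw [Finset.prod_eq_zero (Finset.mem_univ k) (by rw [eval_sub, eval_X, eval_C, sub_self]), mul_zero]
  · -- `j(L) ∉ B`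
    have hMjB : M.j ∉ B := by
      intro hMB
      apply hjB
      rw [hLj]
      rw [hMj] at hMB
      exact mem_valuationSubring_of_intPoly (monic_intModularPolynomial p) hMB (intModularPolynomial_kleinJ_of_jConj i τ)
    refine ⟨hMjB, ?_⟩
    rw [hLj] at hjB
    rw [hMj] at hMjB
    obtain ⟨hj0, hz, hzn⟩ := inv_mem_nonunits_of_not_mem hjB
    have hji0 : jConj i τ ≠ 0 := (inv_mem_nonunits_of_not_mem hMjB).1
    set z : ℂ := (kleinJ τ)⁻¹ with hz_def
    have hzj : z * (kleinJ τ) = 1 := inv_mul_cancel₀ hj0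
    -- the polynomials `B_m`
    obtain ⟨Bm, hBdeg, hBtop, hG⟩ := exists_intPolys_deltaQuotient_mul_X_add_jConj (p := p)
    obtain ⟨cm, hcm⟩ : ∃ cm : ℕ → ℂ, ∀ m, ((Bm m).map (Int.castRingHom ℂ)).eval (kleinJ τ) = cm m := ⟨_, fun _ ↦ rfl⟩
    -- `c_m z^{p+1-m} ∈ B`
    have hcz : ∀ m, cm m * z ^ (p + 1 - m) ∈ B := by
      intro m
      have hdeg := hBdeg m
      rw [← hcm, eval_map, eval₂_eq_sum_range' (Int.castRingHom ℂ) (n := p + 1 - m + 1) (Nat.lt_succ_of_le hdeg),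
        Finset.sum_mul]
      refine Subring.sum_mem _ fun k hk ↦ ?_
      have hk' : k ≤ p + 1 - m := Nat.lt_succ_iff.mp (Finset.mem_range.mp hk)
      have : (Int.castRingHom ℂ) ((Bm m).coeff k) * (kleinJ τ) ^ k * z ^ (p + 1 - m) =
          ((Bm m).coeff k : ℂ) * z ^ (p + 1 - m - k) := by
        rw [eq_intCast, show p + 1 - m = k + (p + 1 - m - k) by omega, pow_add, Nat.add_sub_cancel_left]
        have : (kleinJ τ) ^ k * z ^ k = 1 := by rw [← mul_pow, mul_comm, hzj, one_pow]
        linear_combination ((Bm m).coeff k : ℂ) * z ^ (p + 1 - m - k) * this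
      rw [this]
      exact mul_mem (intCast_mem B _) (pow_mem hz _)
    -- `u = c_0 z^{p+1}` is a unit of `B`
    have hu_mem : cm 0 * z ^ (p + 1) ∈ B := by simpa using hcz 0
    have hu_unit : IsUnit (⟨cm 0 * z ^ (p + 1), hu_mem⟩ : B) := by
      -- `c_0 z^{p+1} = b_{0,p+1} + z · (Σ_{k ≤ p} b_{0,k} z^{p-k})`
      have hdeg : (Bm 0).natDegree ≤ p + 1 := by simpa using hBdeg 0
      have hsplit : cm 0 * z ^ (p + 1) = ((Bm 0).coeff (p + 1) : ℂ) +
          z * ∑ k ∈ Finset.range (p + 1), ((Bm 0).coeff k : ℂ) * z ^ (p - k) := by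
        have h1 : cm 0 = ∑ k ∈ Finset.range (p + 2), ((Bm 0).coeff k : ℂ) * (kleinJ τ) ^ k := by
          rw [← hcm, eval_map, eval₂_eq_sum_range' (Int.castRingHom ℂ) (n := p + 2) (by omega)]
          exact Finset.sum_congr rfl fun k _ ↦ by rw [eq_intCast]
        have h2 : ∀ k ≤ p + 1, ((Bm 0).coeff k : ℂ) * (kleinJ τ) ^ k * z ^ (p + 1) = ((Bm 0).coeff k : ℂ) * z ^ (p + 1 - k) := by
          intro k hk
          rw [show p + 1 = k + (p + 1 - k) by omega, pow_add, Nat.add_sub_cancel_left]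
          have : (kleinJ τ) ^ k * z ^ k = 1 := by rw [← mul_pow, mul_comm, hzj, one_pow]
          linear_combination ((Bm 0).coeff k : ℂ) * z ^ (p + 1 - k) * this
        rw [h1, Finset.sum_mul, Finset.sum_range_succ, h2 (p + 1) le_rfl, Nat.sub_self, pow_zero, mul_one,
          add_comm, Finset.mul_sum]
        congr 1
        refine Finset.sum_congr rfl fun k hk ↦ ?_
        have hk' : k ≤ p := Nat.lt_succ_iff.mp (Finset.mem_range.mp hk)
        rw [h2 k (by omega), show p + 1 - k = (p - k) + 1 by omega, pow_succ]
        ring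
      have hsum_mem : ∑ k ∈ Finset.range (p + 1), ((Bm 0).coeff k : ℂ) * z ^ (p - k) ∈ B :=
        Subring.sum_mem _ fun k _ ↦ mul_mem (intCast_mem B _) (pow_mem hz _)
      have hm : (⟨z, hz⟩ : B) * ⟨_, hsum_mem⟩ ∈ IsLocalRing.maximalIdeal B :=
        Ideal.mul_mem_right _ _ ((IsLocalRing.mem_maximalIdeal _).mpr hzn)
      rcases hBtop with htop | htop
      · have key : (⟨cm 0 * z ^ (p + 1), hu_mem⟩ : B) = 1 - (-(⟨z, hz⟩ * ⟨_, hsum_mem⟩)) := by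
          apply Subtype.ext
          change cm 0 * z ^ (p + 1) = ((1 - (-(⟨z, hz⟩ * ⟨_, hsum_mem⟩)) : B) : ℂ)
          rw [hsplit, htop]
          push_cast
          ring
        rw [key]
        exact IsLocalRing.isUnit_one_sub_self_of_mem_nonunits _
          ((IsLocalRing.mem_maximalIdeal _).mp (neg_mem hm))
      · have key : (⟨cm 0 * z ^ (p + 1), hu_mem⟩ : B) = -(1 - ⟨z, hz⟩ * ⟨_, hsum_mem⟩) := by
          apply Subtype.ext
          change cm 0 * z ^ (p + 1) = ((-(1 - ⟨z, hz⟩ * ⟨_, hsum_mem⟩) : B) : ℂ)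
          rw [hsplit, htop]
          push_cast
          ring
        rw [key]
        exact (IsLocalRing.isUnit_one_sub_self_of_mem_nonunits _ ((IsLocalRing.mem_maximalIdeal _).mp hm)).neg
    -- the inverse of `u` in `B`
    set uinv : ℂ := (((hu_unit.unit⁻¹ : Bˣ) : B) : ℂ) with huinv_def
    have huinv_mem : uinv ∈ B := Subtype.mem _
    have huinv : uinv * (cm 0 * z ^ (p + 1)) = 1 := by
      have h : ((hu_unit.unit⁻¹ : Bˣ) : B) * ⟨cm 0 * z ^ (p + 1), hu_mem⟩ = 1 := hu_unit.val_inv_mul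
      have h' := congr_arg (fun b : B ↦ (b : ℂ)) h
      exact h'
    -- `ν = w j(τ)/j(σ_iτ)` and the vanishing sum `Σ c_m (−j)^m ν^{p+1−m} = 0`
    obtain ⟨ν, hν_def⟩ : ∃ ν : ℂ, ν = w * (kleinJ τ) / jConj i τ := ⟨_, rfl⟩
    have hν0 : ν ≠ 0 := by rw [hν_def]; exact div_ne_zero (mul_ne_zero hw0 hj0) hji0
    have hGeval : ((Polynomial.C (ModularForm.discriminant τ / ModularForm.discriminant (mulPoint p τ)) *
        Polynomial.X + Polynomial.C (kleinJ (mulPoint p τ))) *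
        ∏ k : ZMod p, (Polynomial.C ((p : ℂ) ^ 12 * ModularForm.discriminant τ /
          ModularForm.discriminant (divPoint p (k.val : ℤ) τ)) * Polynomial.X +
            Polynomial.C (kleinJ (divPoint p (k.val : ℤ) τ)))).eval (-(kleinJ τ) / ν) = 0 := by
      rw [eval_mul, eval_prod]
      have hfac : ∀ (a b : ℂ), a = w → b = jConj i τ →
          (Polynomial.C a * Polynomial.X + Polynomial.C b).eval (-(kleinJ τ) / ν) = 0 := by
        rintro a b rfl rfl
        rw [eval_add, eval_mul, eval_C, eval_X, eval_C, hν_def]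
        field_simp
        ring
      cases i with
      | none =>
        rw [hfac _ _ (by rw [hw]; rfl) (by rw [jConj_none]), zero_mul]
      | some k =>
        rw [Finset.prod_eq_zero (Finset.mem_univ k) (hfac _ _ (by rw [hw]; rfl) (by rw [jConj_some])), mul_zero]
    have hGdeg : ((Polynomial.C (ModularForm.discriminant τ / ModularForm.discriminant (mulPoint p τ)) *
        Polynomial.X + Polynomial.C (kleinJ (mulPoint p τ))) *
        ∏ k : ZMod p, (Polynomial.C ((p : ℂ) ^ 12 * ModularForm.discriminant τ /
          ModularForm.discriminant (divPoint p (k.val : ℤ) τ)) * Polynomial.X +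
            Polynomial.C (kleinJ (divPoint p (k.val : ℤ) τ)))).natDegree < p + 2 := by
      refine Nat.lt_succ_of_le ((natDegree_mul_le).trans ?_)
      have h1 : (Polynomial.C (ModularForm.discriminant τ / ModularForm.discriminant (mulPoint p τ)) *
          Polynomial.X + Polynomial.C (kleinJ (mulPoint p τ))).natDegree ≤ 1 := natDegree_linear_le
      have h2 : (∏ k : ZMod p, (Polynomial.C ((p : ℂ) ^ 12 * ModularForm.discriminant τ /
          ModularForm.discriminant (divPoint p (k.val : ℤ) τ)) * Polynomial.X +
            Polynomial.C (kleinJ (divPoint p (k.val : ℤ) τ)))).natDegree ≤ p := by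
        refine (natDegree_prod_le _ _).trans ?_
        refine (Finset.sum_le_card_nsmul _ _ 1 fun k _ ↦ natDegree_linear_le).trans ?_
        rw [Finset.card_univ, ZMod.card, smul_eq_mul, mul_one]
      omega
    have hS : ∑ m ∈ Finset.range (p + 2), cm m * (-(kleinJ τ)) ^ m * ν ^ (p + 1 - m) = 0 := by
      have h := hGeval
      rw [eval_eq_sum_range' hGdeg] at h
      have h2 := congr_arg (· * ν ^ (p + 1)) h
      simp only [zero_mul, Finset.sum_mul] at h2
      rw [← h2]
      refine Finset.sum_congr rfl fun m hm ↦ ?_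
      have hm' : m ≤ p + 1 := Nat.lt_succ_iff.mp (Finset.mem_range.mp hm)
      rw [hG τ m, hcm]
      have hνp : ν ^ (p + 1) = ν ^ m * ν ^ (p + 1 - m) := by rw [← pow_add]; congr 1; omega
      rw [hνp, div_pow, neg_pow]
      field_simp
    -- the monic polynomial `R ∈ B[X]` killing `ν`
    set r : ℕ → ℂ := fun m ↦ (-1) ^ (m + 1) * (cm (m + 1) * z ^ (p - m)) * uinv with hr_def
    have hr_mem : ∀ m, r m ∈ B := fun m ↦ by
      have h := hcz (m + 1)
      rw [show p + 1 - (m + 1) = p - m by omega] at h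
      exact mul_mem (mul_mem (pow_mem (neg_mem (one_mem B)) _) h) huinv_mem
    have hReval : (Polynomial.X ^ (p + 1) + ∑ m ∈ Finset.range (p + 1),
        Polynomial.C (r m) * Polynomial.X ^ (p - m) : Polynomial ℂ).eval ν = 0 := by
      rw [eval_add, eval_pow, eval_X, eval_finsetSum]
      simp only [eval_mul, eval_C, eval_pow, eval_X]
      have h := congr_arg (fun s ↦ uinv * z ^ (p + 1) * s) hS
      simp only [mul_zero, Finset.mul_sum] at h
      rw [Finset.sum_range_succ'] at h
      rw [← h]
      have h0 : uinv * z ^ (p + 1) * (cm 0 * (-(kleinJ τ)) ^ 0 * ν ^ (p + 1 - 0)) = ν ^ (p + 1) := by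
        rw [pow_zero, mul_one, Nat.sub_zero, ← mul_assoc, show uinv * z ^ (p + 1) * cm 0 =
          uinv * (cm 0 * z ^ (p + 1)) by ring, huinv, one_mul]
      rw [h0, add_comm]
      congr 1
      refine Finset.sum_congr rfl fun m hm ↦ ?_
      have hm' : m ≤ p := Nat.lt_succ_iff.mp (Finset.mem_range.mp hm)
      rw [hr_def]
      simp only
      rw [show p + 1 - (m + 1) = p - m by omega]
      have hzp : z ^ (p + 1) = z ^ (p - m) * z ^ (m + 1) := by rw [← pow_add]; congr 1; omega
      have hzj' : (z * (kleinJ τ)) ^ (m + 1) = 1 := by rw [hzj, one_pow]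
      rw [hzp, neg_pow (kleinJ τ)]
      linear_combination (-((-1) ^ (m + 1) * cm (m + 1) * z ^ (p - m) * uinv * ν ^ (p - m))) * hzj'
    have hRmonic : (Polynomial.X ^ (p + 1) + ∑ m ∈ Finset.range (p + 1),
        Polynomial.C (r m) * Polynomial.X ^ (p - m) : Polynomial ℂ).Monic := by
      refine monic_X_pow_add ((degree_sum_le _ _).trans_lt ((Finset.sup_lt_iff (WithBot.bot_lt_coe _)).mpr
        fun m hm ↦ (degree_C_mul_X_pow_le _ _).trans_lt ?_))
      exact_mod_cast (show p - m < p + 1 by omega)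
    have hRcoeff : ∀ n, (Polynomial.X ^ (p + 1) + ∑ m ∈ Finset.range (p + 1),
        Polynomial.C (r m) * Polynomial.X ^ (p - m) : Polynomial ℂ).coeff n ∈ B := by
      intro n
      rw [coeff_add, coeff_X_pow, finsetSum_coeff]
      refine add_mem ?_ (Subring.sum_mem _ fun m _ ↦ ?_)
      · split_ifs
        · exact one_mem B
        · exact zero_mem B
      · rw [coeff_C_mul, coeff_X_pow]
        split_ifs
        · rw [mul_one]; exact hr_mem m
        · rw [mul_zero]; exact zero_mem B
    rw [hν, ← hν_def]
    exact mem_valuationSubring_of_monic_of_eval_eq_zero hRmonic hRcoeff hReval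

end Hecke

/-! ### The dichotomy only depends on the lattices, and is transitive -/

/-- The dichotomy only depends on the two lattices. [folklore] -/
theorem valuationSubring_dichotomy_congr {M L M' L' : PeriodPair} (hM : M.lattice = M'.lattice)
    (hL : L.lattice = L'.lattice) (B : ValuationSubring ℂ)
    (h : (L'.j ∈ B → M'.j ∈ B ∧ (L'.g₂ ^ 3 - 27 * L'.g₃ ^ 2) / (M'.g₂ ^ 3 - 27 * M'.g₃ ^ 2) ∈ B) ∧
      (L'.j ∉ B → M'.j ∉ B ∧ L'.g₂ ^ 3 / M'.g₂ ^ 3 ∈ B)) :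
    (L.j ∈ B → M.j ∈ B ∧ (L.g₂ ^ 3 - 27 * L.g₃ ^ 2) / (M.g₂ ^ 3 - 27 * M.g₃ ^ 2) ∈ B) ∧
      (L.j ∉ B → M.j ∉ B ∧ L.g₂ ^ 3 / M.g₂ ^ 3 ∈ B) := by
  rw [j_eq_of_lattice_eq hM, j_eq_of_lattice_eq hL, g₂_eq_of_lattice_eq hM, g₂_eq_of_lattice_eq hL,
    g₃_eq_of_lattice_eq hM, g₃_eq_of_lattice_eq hL]
  exact h

/-- The dichotomy for `M = L` (as lattices). [folklore] -/
theorem valuationSubring_dichotomy_of_lattice_eq {M L : PeriodPair} (h : M.lattice = L.lattice) (B : ValuationSubring ℂ) :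
    (L.j ∈ B → M.j ∈ B ∧ (L.g₂ ^ 3 - 27 * L.g₃ ^ 2) / (M.g₂ ^ 3 - 27 * M.g₃ ^ 2) ∈ B) ∧
      (L.j ∉ B → M.j ∉ B ∧ L.g₂ ^ 3 / M.g₂ ^ 3 ∈ B) := by
  rw [j_eq_of_lattice_eq h, g₂_eq_of_lattice_eq h, g₃_eq_of_lattice_eq h, div_self L.discr_ne_zero]
  refine ⟨fun hj ↦ ⟨hj, one_mem B⟩, fun hj ↦ ⟨hj, ?_⟩⟩
  by_cases h0 : L.g₂ ^ 3 = 0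
  · rw [h0, div_zero]; exact zero_mem B
  · rw [div_self h0]; exact one_mem B

/-- If `j(Λ) ∉ B` then `g₂(Λ) ≠ 0` (`j = 1728 g₂³/Δ` and `0 ∈ B`). [folklore] -/
theorem g₂_ne_zero_of_j_not_mem {K : PeriodPair} {B : ValuationSubring ℂ} (h : K.j ∉ B) : K.g₂ ≠ 0 := by
  intro h0
  apply h
  rw [j, h0]
  simp

/-- **Transitivity of the dichotomy along `M ⊆ K ⊆ L`.** [folklore] -/
theorem valuationSubring_dichotomy_trans {M K L : PeriodPair} (B : ValuationSubring ℂ)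
    (h₁ : (L.j ∈ B → K.j ∈ B ∧ (L.g₂ ^ 3 - 27 * L.g₃ ^ 2) / (K.g₂ ^ 3 - 27 * K.g₃ ^ 2) ∈ B) ∧
      (L.j ∉ B → K.j ∉ B ∧ L.g₂ ^ 3 / K.g₂ ^ 3 ∈ B))
    (h₂ : (K.j ∈ B → M.j ∈ B ∧ (K.g₂ ^ 3 - 27 * K.g₃ ^ 2) / (M.g₂ ^ 3 - 27 * M.g₃ ^ 2) ∈ B) ∧
      (K.j ∉ B → M.j ∉ B ∧ K.g₂ ^ 3 / M.g₂ ^ 3 ∈ B)) :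
    (L.j ∈ B → M.j ∈ B ∧ (L.g₂ ^ 3 - 27 * L.g₃ ^ 2) / (M.g₂ ^ 3 - 27 * M.g₃ ^ 2) ∈ B) ∧
      (L.j ∉ B → M.j ∉ B ∧ L.g₂ ^ 3 / M.g₂ ^ 3 ∈ B) := by
  refine ⟨fun hL ↦ ?_, fun hL ↦ ?_⟩
  · obtain ⟨hK, hx⟩ := h₁.1 hL
    obtain ⟨hM, hy⟩ := h₂.1 hK
    refine ⟨hM, ?_⟩
    have hKΔ := K.discr_ne_zero
    have : (L.g₂ ^ 3 - 27 * L.g₃ ^ 2) / (M.g₂ ^ 3 - 27 * M.g₃ ^ 2) =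
        (L.g₂ ^ 3 - 27 * L.g₃ ^ 2) / (K.g₂ ^ 3 - 27 * K.g₃ ^ 2) *
          ((K.g₂ ^ 3 - 27 * K.g₃ ^ 2) / (M.g₂ ^ 3 - 27 * M.g₃ ^ 2)) := by
      rw [div_mul_div_cancel₀ hKΔ]
    rw [this]
    exact mul_mem hx hy
  · obtain ⟨hK, hx⟩ := h₁.2 hL
    obtain ⟨hM, hy⟩ := h₂.2 hK
    refine ⟨hM, ?_⟩
    have hKg : K.g₂ ^ 3 ≠ 0 := pow_ne_zero _ (g₂_ne_zero_of_j_not_mem hK)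
    have : L.g₂ ^ 3 / M.g₂ ^ 3 = L.g₂ ^ 3 / K.g₂ ^ 3 * (K.g₂ ^ 3 / M.g₂ ^ 3) := by
      rw [div_mul_div_cancel₀ hKg]
    rw [this]
    exact mul_mem hx hy

/-! ### Stacked bases: `ℤpX₁ + ℤX₂ ⊆ ℤX₁ + ℤX₂` is in Hermite form -/

/-- Scaling the first period by a non-zero natural number keeps `ℝ`-independence. [folklore] -/
theorem indep_natCast_mul_fst {X₁ X₂ : ℂ} (hX : LinearIndependent ℝ ![X₁, X₂]) {n : ℕ} (hn : n ≠ 0) :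
    LinearIndependent ℝ ![(n : ℂ) * X₁, X₂] := by
  refine LinearIndependent.pair_iff.mpr fun s t h ↦ ?_
  have h' : (s * n) • X₁ + t • X₂ = 0 := by
    rw [← h, Complex.real_smul, Complex.real_smul, Complex.real_smul]
    push_cast
    ring
  obtain ⟨h1, h2⟩ := LinearIndependent.pair_iff.mp hX _ _ h'
  refine ⟨?_, h2⟩
  have hn' : (n : ℝ) ≠ 0 := Nat.cast_ne_zero.mpr hn
  exact (mul_eq_zero.mp h1).resolve_right hn'

/-- Swapping the periods keeps `ℝ`-independence: the forward direction of Mathlib's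
`LinearIndependent.pair_symm_iff`; deprecated restatement (dedup-01118, 2026-08-16). [folklore] -/
@[deprecated LinearIndependent.pair_symm_iff (since := "2026-08-16")]
theorem indep_swap {X₁ X₂ : ℂ} (hX : LinearIndependent ℝ ![X₁, X₂]) :
    LinearIndependent ℝ ![X₂, X₁] :=
  LinearIndependent.pair_symm_iff.mp hX

/-- Scaling the second period by a non-zero natural number keeps `ℝ`-independence. [folklore] -/
theorem indep_natCast_mul_snd {X₁ X₂ : ℂ} (hX : LinearIndependent ℝ ![X₁, X₂]) {n : ℕ} (hn : n ≠ 0) :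
    LinearIndependent ℝ ![X₁, (n : ℂ) * X₂] :=
  LinearIndependent.pair_symm_iff.mp
    (indep_natCast_mul_fst (LinearIndependent.pair_symm_iff.mp hX) hn)

/-- Period pairs with the same (resp. swapped) periods span the same lattice. [folklore] -/
theorem lattice_eq_of_ω_eq {P Q : PeriodPair} (h₁ : P.ω₁ = Q.ω₁) (h₂ : P.ω₂ = Q.ω₂) : P.lattice = Q.lattice := by
  simp only [lattice, h₁, h₂]

/-- Period pairs with swapped periods span the same lattice. [folklore] -/
theorem lattice_eq_of_ω_swap {P Q : PeriodPair} (h₁ : P.ω₁ = Q.ω₂) (h₂ : P.ω₂ = Q.ω₁) : P.lattice = Q.lattice := by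
  simp only [lattice, h₁, h₂, Set.pair_comm]

/-- **`ℤpX₁ + ℤX₂ ⊆ ℤX₁ + ℤX₂` is in Hermite form**, so the dichotomy holds for it: with
`τ = X₁/X₂` (if `Im τ > 0`: `ℤX₁ + ℤX₂ = X₂(ℤτ + ℤ)`, `ℤpX₁ + ℤX₂ = X₂(ℤpτ + ℤ)`) or `τ = X₂/X₁`
(if `Im(X₁/X₂) < 0`: `ℤX₁ + ℤX₂ = X₁(ℤτ + ℤ)`, `ℤpX₁ + ℤX₂ = X₁(ℤ(τ + 0) + ℤp)`).
[cite: Lang1987, Ch. 12 §2 Thm. 2–4 (PDF pp. 124–125)] -/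
theorem valuationSubring_dichotomy_prime_mul_fst {X₁ X₂ : ℂ} (hX : LinearIndependent ℝ ![X₁, X₂]) {p : ℕ}
    (hp : p.Prime) (B : ValuationSubring ℂ) :
    ((⟨X₁, X₂, hX⟩ : PeriodPair).j ∈ B → (⟨(p : ℂ) * X₁, X₂, indep_natCast_mul_fst hX hp.ne_zero⟩ : PeriodPair).j ∈ B ∧
      ((⟨X₁, X₂, hX⟩ : PeriodPair).g₂ ^ 3 - 27 * (⟨X₁, X₂, hX⟩ : PeriodPair).g₃ ^ 2) /
        ((⟨(p : ℂ) * X₁, X₂, indep_natCast_mul_fst hX hp.ne_zero⟩ : PeriodPair).g₂ ^ 3 -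
          27 * (⟨(p : ℂ) * X₁, X₂, indep_natCast_mul_fst hX hp.ne_zero⟩ : PeriodPair).g₃ ^ 2) ∈ B) ∧
    ((⟨X₁, X₂, hX⟩ : PeriodPair).j ∉ B → (⟨(p : ℂ) * X₁, X₂, indep_natCast_mul_fst hX hp.ne_zero⟩ : PeriodPair).j ∉ B ∧
      (⟨X₁, X₂, hX⟩ : PeriodPair).g₂ ^ 3 /
        (⟨(p : ℂ) * X₁, X₂, indep_natCast_mul_fst hX hp.ne_zero⟩ : PeriodPair).g₂ ^ 3 ∈ B) := by
  haveI : Fact p.Prime := ⟨hp⟩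
  set L₀ : PeriodPair := ⟨X₁, X₂, hX⟩ with hL₀
  set M₀ : PeriodPair := ⟨(p : ℂ) * X₁, X₂, indep_natCast_mul_fst hX hp.ne_zero⟩ with hM₀
  have h1 : X₁ ≠ 0 := by simpa using hX.ne_zero 0
  have h2 : X₂ ≠ 0 := by simpa using hX.ne_zero 1
  have hpC : (p : ℂ) ≠ 0 := modularLevel_ne_zero
  have him : (X₁ / X₂).im ≠ 0 := L₀.im_ω₁_div_ω₂_ne_zero
  rcases lt_or_gt_of_ne him with hneg | hpos
  · -- `τ = X₂/X₁`
    have hpos' : 0 < (X₂ / X₁).im := by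
      rw [show X₂ / X₁ = (X₁ / X₂)⁻¹ by rw [inv_div], Complex.inv_im, neg_div, Left.neg_pos_iff]
      exact div_neg_of_neg_of_pos hneg (Complex.normSq_pos.mpr (div_ne_zero h1 h2))
    set τ : ℍ := ⟨X₂ / X₁, hpos'⟩ with hτ
    have hL : L₀.lattice = ((ofUpperHalfPlane τ).mulLeft X₁ h1).lattice := by
      refine lattice_eq_of_ω_swap ?_ ?_
      · change X₁ = X₁ * (ofUpperHalfPlane τ).ω₂
        rw [ofUpperHalfPlane_ω₂, mul_one]
      · change X₂ = X₁ * (ofUpperHalfPlane τ).ω₁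
        rw [ofUpperHalfPlane_ω₁]
        change X₂ = X₁ * (X₂ / X₁)
        rw [mul_div_cancel₀ _ h1]
    have hM : M₀.lattice = ((ofUpperHalfPlane (divPoint p ((0 : ZMod p).val : ℤ) τ)).mulLeft (X₁ * p)
        (mul_ne_zero h1 modularLevel_ne_zero)).lattice := by
      refine lattice_eq_of_ω_swap ?_ ?_
      · change (p : ℂ) * X₁ = X₁ * p * (ofUpperHalfPlane _).ω₂
        rw [ofUpperHalfPlane_ω₂, mul_one, mul_comm]
      · change X₂ = X₁ * p * (ofUpperHalfPlane _).ω₁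
        rw [ofUpperHalfPlane_ω₁, coe_divPoint, ZMod.val_zero]
        push_cast
        change X₂ = X₁ * p * ((X₂ / X₁ + 0) / p)
        rw [add_zero]
        field_simp
    exact valuationSubring_dichotomy_of_heckeData (p := p) hL (some 0) (by simpa only [Option.elim_some] using hM) B
  · -- `τ = X₁/X₂`
    set τ : ℍ := ⟨X₁ / X₂, hpos⟩ with hτ
    have hL : L₀.lattice = ((ofUpperHalfPlane τ).mulLeft X₂ h2).lattice := by
      refine lattice_eq_of_ω_eq ?_ ?_
      · change X₁ = X₂ * (ofUpperHalfPlane τ).ω₁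
        rw [ofUpperHalfPlane_ω₁]
        change X₁ = X₂ * (X₁ / X₂)
        rw [mul_div_cancel₀ _ h2]
      · change X₂ = X₂ * (ofUpperHalfPlane τ).ω₂
        rw [ofUpperHalfPlane_ω₂, mul_one]
    have hM : M₀.lattice = ((ofUpperHalfPlane (mulPoint p τ)).mulLeft X₂ h2).lattice := by
      refine lattice_eq_of_ω_eq ?_ ?_
      · change (p : ℂ) * X₁ = X₂ * (ofUpperHalfPlane _).ω₁
        rw [ofUpperHalfPlane_ω₁, coe_mulPoint]
        change (p : ℂ) * X₁ = X₂ * (p * (X₁ / X₂))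
        field_simp
      · change X₂ = X₂ * (ofUpperHalfPlane _).ω₂
        rw [ofUpperHalfPlane_ω₂, mul_one]
    exact valuationSubring_dichotomy_of_heckeData (p := p) hL none (by simpa only [Option.elim_none] using hM) B

/-- **The dichotomy for `ℤnX₁ + ℤX₂ ⊆ ℤX₁ + ℤX₂`**, by induction on the prime factorisation of `n`
(`ℤabX₁ + ℤX₂ ⊆ ℤbX₁ + ℤX₂ ⊆ ℤX₁ + ℤX₂` and transitivity). [folklore] -/
theorem valuationSubring_dichotomy_natCast_mul_fst (n : ℕ) : ∀ {X₁ X₂ : ℂ} (hX : LinearIndependent ℝ ![X₁, X₂])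
    (hn : n ≠ 0) (B : ValuationSubring ℂ),
    ((⟨X₁, X₂, hX⟩ : PeriodPair).j ∈ B → (⟨(n : ℂ) * X₁, X₂, indep_natCast_mul_fst hX hn⟩ : PeriodPair).j ∈ B ∧
      ((⟨X₁, X₂, hX⟩ : PeriodPair).g₂ ^ 3 - 27 * (⟨X₁, X₂, hX⟩ : PeriodPair).g₃ ^ 2) /
        ((⟨(n : ℂ) * X₁, X₂, indep_natCast_mul_fst hX hn⟩ : PeriodPair).g₂ ^ 3 -
          27 * (⟨(n : ℂ) * X₁, X₂, indep_natCast_mul_fst hX hn⟩ : PeriodPair).g₃ ^ 2) ∈ B) ∧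
    ((⟨X₁, X₂, hX⟩ : PeriodPair).j ∉ B → (⟨(n : ℂ) * X₁, X₂, indep_natCast_mul_fst hX hn⟩ : PeriodPair).j ∉ B ∧
      (⟨X₁, X₂, hX⟩ : PeriodPair).g₂ ^ 3 /
        (⟨(n : ℂ) * X₁, X₂, indep_natCast_mul_fst hX hn⟩ : PeriodPair).g₂ ^ 3 ∈ B) := by
  induction n using Nat.recOnMul with
  | zero => intro X₁ X₂ hX hn B; exact absurd rfl hn
  | one =>
    intro X₁ X₂ hX hn B
    refine valuationSubring_dichotomy_of_lattice_eq (M := ⟨((1 : ℕ) : ℂ) * X₁, X₂, indep_natCast_mul_fst hX hn⟩)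
      (L := ⟨X₁, X₂, hX⟩) (lattice_eq_of_ω_eq ?_ rfl) B
    change ((1 : ℕ) : ℂ) * X₁ = X₁
    rw [Nat.cast_one, one_mul]
  | prime p hp => intro X₁ X₂ hX hn B; exact valuationSubring_dichotomy_prime_mul_fst hX hp B
  | mul a b iha ihb =>
    intro X₁ X₂ hX hn B
    have ha : a ≠ 0 := left_ne_zero_of_mul hn
    have hb : b ≠ 0 := right_ne_zero_of_mul hn
    have h₂ := ihb hX hb B
    have h₁ := iha (indep_natCast_mul_fst hX hb) ha B
    have key := valuationSubring_dichotomy_trans B h₂ h₁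
    refine valuationSubring_dichotomy_congr (M := ⟨((a * b : ℕ) : ℂ) * X₁, X₂, indep_natCast_mul_fst hX hn⟩)
      (L := ⟨X₁, X₂, hX⟩) (M' := ⟨(a : ℂ) * ((b : ℂ) * X₁), X₂, indep_natCast_mul_fst (indep_natCast_mul_fst hX hb) ha⟩)
      (L' := ⟨X₁, X₂, hX⟩) (lattice_eq_of_ω_eq ?_ rfl) rfl B key
    change ((a * b : ℕ) : ℂ) * X₁ = (a : ℂ) * ((b : ℂ) * X₁)
    push_cast
    ring

/-- The dichotomy for `ℤX₁ + ℤnX₂ ⊆ ℤX₁ + ℤX₂` (swap the periods). [folklore] -/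
theorem valuationSubring_dichotomy_natCast_mul_snd {X₁ X₂ : ℂ} (hX : LinearIndependent ℝ ![X₁, X₂]) {n : ℕ}
    (hn : n ≠ 0) (B : ValuationSubring ℂ) :
    ((⟨X₁, X₂, hX⟩ : PeriodPair).j ∈ B → (⟨X₁, (n : ℂ) * X₂, indep_natCast_mul_snd hX hn⟩ : PeriodPair).j ∈ B ∧
      ((⟨X₁, X₂, hX⟩ : PeriodPair).g₂ ^ 3 - 27 * (⟨X₁, X₂, hX⟩ : PeriodPair).g₃ ^ 2) /
        ((⟨X₁, (n : ℂ) * X₂, indep_natCast_mul_snd hX hn⟩ : PeriodPair).g₂ ^ 3 -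
          27 * (⟨X₁, (n : ℂ) * X₂, indep_natCast_mul_snd hX hn⟩ : PeriodPair).g₃ ^ 2) ∈ B) ∧
    ((⟨X₁, X₂, hX⟩ : PeriodPair).j ∉ B → (⟨X₁, (n : ℂ) * X₂, indep_natCast_mul_snd hX hn⟩ : PeriodPair).j ∉ B ∧
      (⟨X₁, X₂, hX⟩ : PeriodPair).g₂ ^ 3 /
        (⟨X₁, (n : ℂ) * X₂, indep_natCast_mul_snd hX hn⟩ : PeriodPair).g₂ ^ 3 ∈ B) := by
  have key := valuationSubring_dichotomy_natCast_mul_fst n (LinearIndependent.pair_symm_iff.mp hX)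
    hn B
  exact valuationSubring_dichotomy_congr (M := ⟨X₁, (n : ℂ) * X₂, indep_natCast_mul_snd hX hn⟩) (L := ⟨X₁, X₂, hX⟩)
    (M' := ⟨(n : ℂ) * X₂, X₁, indep_natCast_mul_fst (LinearIndependent.pair_symm_iff.mp hX) hn⟩)
    (L' := ⟨X₂, X₁, LinearIndependent.pair_symm_iff.mp hX⟩)
    (lattice_eq_of_ω_swap rfl rfl) (lattice_eq_of_ω_swap rfl rfl) B key

/-! ### Every sublattice: the Smith normal form -/

/-- A pair indexed by `Fin 2` has range `{f 0, f 1}`. [folklore] -/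
theorem range_fin_two {α : Type*} (f : Fin 2 → α) : Set.range f = {f 0, f 1} := by
  ext x
  simp only [Set.mem_range, Set.mem_insert_iff, Set.mem_singleton_iff]
  constructor
  · rintro ⟨i, rfl⟩
    fin_cases i
    · left; rfl
    · right; rfl
  · rintro (rfl | rfl)
    exacts [⟨0, rfl⟩, ⟨1, rfl⟩]

/-- `ℤ(−x) + ℤy = ℤx + ℤy`. [folklore] -/
theorem span_pair_neg_left (x y : ℂ) : Submodule.span ℤ ({-x, y} : Set ℂ) = Submodule.span ℤ {x, y} := by
  have key : ∀ u v : ℂ, Submodule.span ℤ ({-u, v} : Set ℂ) ≤ Submodule.span ℤ {u, v} := by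
    intro u v
    rw [Submodule.span_le]
    intro z hz
    rcases hz with rfl | rfl
    · exact Submodule.neg_mem _ (Submodule.subset_span (Set.mem_insert u _))
    · exact Submodule.subset_span (Set.mem_insert_of_mem _ rfl)
  refine le_antisymm (key x y) ?_
  simpa using key (-x) y

/-- `ℤax + ℤy = ℤ|a|x + ℤy` for an integer `a`. [folklore] -/
theorem span_pair_intCast_mul_left (a : ℤ) (x y : ℂ) :
    Submodule.span ℤ ({(a : ℂ) * x, y} : Set ℂ) = Submodule.span ℤ {((a.natAbs : ℕ) : ℂ) * x, y} := by
  rcases Int.natAbs_eq a with h | h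
  · rw [h, Int.natAbs_natCast, Int.cast_natCast]
  · conv_lhs => rw [h]
    rw [Int.cast_neg, Int.cast_natCast, neg_mul, span_pair_neg_left]

/-- **Stacked bases for a sublattice** (Smith normal form over `ℤ`): if `M.lattice ≤ L.lattice` for
period pairs `M, L`, there are `ℝ`-independent `B₁, B₂` and natural numbers `n₁, n₂ ≠ 0` with
`L = ℤB₁ + ℤB₂` and `M = ℤn₁B₁ + ℤn₂B₂`. [folklore] -/
theorem exists_stacked_bases {M L : PeriodPair} (h : M.lattice ≤ L.lattice) :
    ∃ (B₁ B₂ : ℂ) (hB : LinearIndependent ℝ ![B₁, B₂]) (n₁ n₂ : ℕ), n₁ ≠ 0 ∧ n₂ ≠ 0 ∧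
      L.lattice = (⟨B₁, B₂, hB⟩ : PeriodPair).lattice ∧
      M.lattice = Submodule.span ℤ {(n₁ : ℂ) * B₁, (n₂ : ℂ) * B₂} := by
  set N : Submodule ℤ L.lattice := Submodule.comap L.lattice.subtype M.lattice with hN
  have e : N ≃ₗ[ℤ] M.lattice := Submodule.comapSubtypeEquivOfLe h
  have hrankL : Module.finrank ℤ L.lattice = 2 := by rw [ZLattice.rank ℝ L.lattice, Complex.finrank_real_complex]
  have hrankM : Module.finrank ℤ M.lattice = 2 := by rw [ZLattice.rank ℝ M.lattice, Complex.finrank_real_complex]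
  have hrank : Module.finrank ℤ N = Module.finrank ℤ L.lattice := by
    rw [e.finrank_eq, hrankM, hrankL]
  obtain ⟨b', a, ab', hab'⟩ := Submodule.exists_smith_normal_form_of_rank_eq L.latticeBasis hrank
  set X : Fin 2 → ℂ := fun i ↦ ((b' i : L.lattice) : ℂ) with hXdef
  -- `L = ℤX₀ + ℤX₁`
  have hLspan : L.lattice = Submodule.span ℤ {X 0, X 1} := by
    conv_lhs => rw [← Submodule.map_subtype_top L.lattice, ← b'.span_eq, Submodule.map_span]
    congr 1
    rw [← Set.range_comp, range_fin_two]
    rfl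
  -- `M = ℤa₀X₀ + ℤa₁X₁`
  have hMspan : M.lattice = Submodule.span ℤ {(a 0 : ℂ) * X 0, (a 1 : ℂ) * X 1} := by
    have hM : M.lattice = N.map L.lattice.subtype := by
      rw [hN, Submodule.map_comap_subtype, inf_eq_right.mpr h]
    have hNspan : N = Submodule.span ℤ (Set.range fun i ↦ (ab' i : L.lattice)) := by
      conv_lhs => rw [← Submodule.map_subtype_top N, ← ab'.span_eq, Submodule.map_span]
      congr 1
      rw [← Set.range_comp]
      rfl
    rw [hM, hNspan, Submodule.map_span, ← Set.range_comp, range_fin_two]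
    congr 1
    simp only [Function.comp_apply, hab', Submodule.coe_subtype, Submodule.coe_smul, zsmul_eq_mul, hXdef]
  -- independence over `ℝ`
  have hspan : (⊤ : Submodule ℝ ℂ) ≤ Submodule.span ℝ (Set.range ![X 0, X 1]) := by
    have h1 : Submodule.span ℝ (L.lattice : Set ℂ) = ⊤ := IsZLattice.span_top
    rw [← h1, Submodule.span_le, hLspan]
    have h2 : (Set.range ![X 0, X 1]) = {X 0, X 1} := by rw [range_fin_two]; rfl
    rw [h2]
    intro z hz
    exact Submodule.span_le_restrictScalars ℤ ℝ _ hz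
  have hB : LinearIndependent ℝ ![X 0, X 1] :=
    linearIndependent_of_top_le_span_of_card_eq_finrank hspan (by rw [Fintype.card_fin, Complex.finrank_real_complex])
  -- the coefficients are non-zero
  have ha : ∀ i, a i ≠ 0 := fun i h0 ↦ by
    apply ab'.ne_zero i
    have := hab' i
    rw [h0, zero_smul] at this
    exact_mod_cast this
  refine ⟨X 0, X 1, hB, (a 0).natAbs, (a 1).natAbs, Int.natAbs_ne_zero.mpr (ha 0), Int.natAbs_ne_zero.mpr (ha 1),
    hLspan, ?_⟩
  rw [hMspan, span_pair_intCast_mul_left, Set.pair_comm, span_pair_intCast_mul_left, Set.pair_comm]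

/-- **The dichotomy for every sublattice.**  Let `M, L` be period pairs with `M.lattice ≤ L.lattice`
and `B ⊆ ℂ` a valuation subring.  Then `j(L) ∈ B ⟹ j(M) ∈ B ∧ Δ(L)/Δ(M) ∈ B`, and
`j(L) ∉ B ⟹ j(M) ∉ B ∧ g₂(L)³/g₂(M)³ ∈ B` (`Δ = g₂³ − 27g₃²`).  For an isogeny of complex elliptic
curves `ℂ/Λ → ℂ/Λ'`, `z ↦ αz` (so `M = αΛ ⊆ L = Λ'`), `Δ(L)/Δ(M)` and `g₂(L)³/g₂(M)³` are the
quantities `Δ'α¹²/Δ` and `c₄'³α¹²/c₄³` of the finite part of Faltings' isogeny lemma.  Proof: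
stacked bases (`exists_stacked_bases`), the prime steps in Hermite form
(`valuationSubring_dichotomy_prime_mul_fst`, i.e. Lang's Thm. 12.2.2–4 and the modular equation), and
transitivity. [cite: Lang1987, Ch. 12 §2 Thm. 2–4 (PDF pp. 124–125); Faltings1986FinitenessTranslation, §3 Lemma 5 (proof)] -/
theorem valuationSubring_dichotomy_of_le {M L : PeriodPair} (h : M.lattice ≤ L.lattice) (B : ValuationSubring ℂ) :
    (L.j ∈ B → M.j ∈ B ∧ (L.g₂ ^ 3 - 27 * L.g₃ ^ 2) / (M.g₂ ^ 3 - 27 * M.g₃ ^ 2) ∈ B) ∧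
      (L.j ∉ B → M.j ∉ B ∧ L.g₂ ^ 3 / M.g₂ ^ 3 ∈ B) := by
  obtain ⟨B₁, B₂, hB, n₁, n₂, hn₁, hn₂, hL, hM⟩ := exists_stacked_bases h
  have h₂ := valuationSubring_dichotomy_natCast_mul_snd hB hn₂ B
  have h₁ := valuationSubring_dichotomy_natCast_mul_fst n₁ (indep_natCast_mul_snd hB hn₂) hn₁ B
  have key := valuationSubring_dichotomy_trans B h₂ h₁
  exact valuationSubring_dichotomy_congr (M' := ⟨(n₁ : ℂ) * B₁, (n₂ : ℂ) * B₂,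
    indep_natCast_mul_fst (indep_natCast_mul_snd hB hn₂) hn₁⟩) (L' := ⟨B₁, B₂, hB⟩) (hM.trans rfl) hL B key




end PeriodPair

end SublatticeDichotomy

section FinitePart


open scoped Classical nonZeroDivisors

universe u

/-! ### The multiplier of an isogeny is determined by the coordinate identity -/

namespace WeierstrassCurve

namespace Isogeny

open Literature.NumberTheory.EllipticCurves PeriodPair

variable {K : Type u} [Field K] [CharZero K] {E E' : WeierstrassCurve K}

/-- **Uniqueness of the multiplier.**  For an isogeny `ψ : E → E'` of elliptic curves over a field
of characteristic `0` with `E'` in `a₁' = a₃' = 0` form, two scalars satisfying the coordinate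
identity `α · 2P₂Q₁² = (δP₁·Q₁ − P₁·δQ₁)·Q₂` on `E(K̄)` for all rational representations coincide:
at a point `P₀` off the exceptional set of a representation with `ψ(P₀) ∉ E'[2]` the factor
`2P₂Q₁²` does not vanish (the good point of the proof of `exists_multiplier_of_isShort`).
[cite: SilvermanAEC2009, III.5 (PDF p. 75) and Thm. VI.4.1(b)] -/
theorem multiplier_unique [E.IsElliptic] [E'.IsElliptic] (ψ : Isogeny E E') (h₁' : E'.a₁ = 0)
    (h₃' : E'.a₃ = 0) {α β : K}
    (hα : ∀ (ρ : RatRep E E' ψ) (x y : AlgebraicClosure K)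
      (_ : (E.baseChange (AlgebraicClosure K)).toAffine.Nonsingular x y),
      algebraMap K (AlgebraicClosure K) α *
          MvPolynomial.eval ![x, y] (MvPolynomial.C 2 * ρ.P₂ * ρ.Q₁ ^ 2) =
        MvPolynomial.eval ![x, y]
          (((E.baseChange (AlgebraicClosure K)).invariantDerivation ρ.P₁ * ρ.Q₁ -
            ρ.P₁ * (E.baseChange (AlgebraicClosure K)).invariantDerivation ρ.Q₁) * ρ.Q₂))
    (hβ : ∀ (ρ : RatRep E E' ψ) (x y : AlgebraicClosure K)
      (_ : (E.baseChange (AlgebraicClosure K)).toAffine.Nonsingular x y),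
      algebraMap K (AlgebraicClosure K) β *
          MvPolynomial.eval ![x, y] (MvPolynomial.C 2 * ρ.P₂ * ρ.Q₁ ^ 2) =
        MvPolynomial.eval ![x, y]
          (((E.baseChange (AlgebraicClosure K)).invariantDerivation ρ.P₁ * ρ.Q₁ -
            ρ.P₁ * (E.baseChange (AlgebraicClosure K)).invariantDerivation ρ.Q₁) * ρ.Q₂)) :
    α = β := by
  classical
  -- a good point `P₀ = (x₀, y₀)`: off the exceptional set of `ρ₀`, `ψ P₀ ∉ E'[2]`
  set ρ₀ : RatRep E E' ψ := ψ.ratRep with hρ₀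
  have hE2fin : {m : E.geomPoints | (2 : ℕ) • ψ m = 0}.Finite := by
    haveI : (E'.baseChange (AlgebraicClosure K)).IsElliptic := by
      rw [WeierstrassCurve.baseChange]; infer_instance
    have hcard : Nat.card (AddSubgroup.torsionBy E'.geomPoints ((2 : ℕ) : ℤ)) = 2 ^ 2 :=
      WeierstrassCurve.card_torsionBy_eq_sq (E := E'.baseChange (AlgebraicClosure K)) (n := 2)
        (by norm_num)
    have hfin2 : (AddSubgroup.torsionBy E'.geomPoints ((2 : ℕ) : ℤ) : Set E'.geomPoints).Finite := by
      have : Finite (AddSubgroup.torsionBy E'.geomPoints ((2 : ℕ) : ℤ)) :=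
        Nat.finite_of_card_ne_zero (by rw [hcard]; norm_num)
      exact Set.toFinite _
    have hpre := PeriodPair.finite_preimage_of_finite_ker ψ.toAddMonoidHom ψ.finite_ker hfin2
    refine hpre.subset fun m hm ↦ ?_
    simp only [Set.mem_setOf_eq] at hm
    simp only [Set.mem_preimage, SetLike.mem_coe, AddSubgroup.torsionBy.nsmul_iff,
      Isogeny.coe_toAddMonoidHom]
    exact hm
  obtain ⟨P₀, hP₀⟩ :=
    Infinite.exists_notMem_finset ((ρ₀.exc : Finset E.geomPoints) ∪ hE2fin.toFinset)
  rw [Finset.mem_union, not_or] at hP₀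
  obtain ⟨hP₀exc, hP₀2⟩ := hP₀
  have hP₀2' : ¬ (2 : ℕ) • ψ P₀ = 0 := fun h ↦ hP₀2 (hE2fin.mem_toFinset.2 h)
  obtain ⟨x₀, y₀, h₀, rfl⟩ : ∃ x₀ y₀ h₀, P₀ = .some x₀ y₀ h₀ := by
    change (E.baseChange (AlgebraicClosure K)).toAffine.Point at P₀
    rcases P₀ with _ | ⟨x₀, y₀, h₀⟩
    · exact (hP₀exc ρ₀.zero_mem_exc).elim
    · exact ⟨x₀, y₀, h₀, rfl⟩
  obtain ⟨hQ₁0, hQ₂0, h₀', hψP₀⟩ := ρ₀.apply_eq_of_not_mem_exc h₀ hP₀exc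
  have hP₂0 : MvPolynomial.eval ![x₀, y₀] ρ₀.P₂ ≠ 0 := by
    intro h0
    apply hP₀2'
    have hy : MvPolynomial.eval ![x₀, y₀] ρ₀.P₂ / MvPolynomial.eval ![x₀, y₀] ρ₀.Q₂ = 0 := by
      rw [h0, zero_div]
    rw [hψP₀]
    exact two_nsmul_eq_zero_of_y_eq_zero (W := E') h₁' h₃' h₀' hy
  have hD₀ne : MvPolynomial.eval ![x₀, y₀] (MvPolynomial.C 2 * ρ₀.P₂ * ρ₀.Q₁ ^ 2) ≠ 0 := by
    simp only [map_mul, map_pow, MvPolynomial.eval_C]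
    exact mul_ne_zero (mul_ne_zero two_ne_zero hP₂0) (pow_ne_zero 2 hQ₁0)
  have h := (hα ρ₀ x₀ y₀ h₀).trans (hβ ρ₀ x₀ y₀ h₀).symm
  exact (algebraMap K (AlgebraicClosure K)).injective (mul_right_cancel₀ hD₀ne h)

end Isogeny

end WeierstrassCurve

/-! ### `ord_v` and the `v`-adic valuation; a valuation subring of `ℂ` above `v` -/

namespace Literature.NumberTheory.DiophantineGeometry

open NumberField IsDedekindDomain IsDedekindDomain.HeightOneSpectrum

variable {K : Type*} [Field K] [NumberField K]

/-- **`|y|_v = exp(−ord_v y)`**: for `y ≠ 0` in a number field, the `v`-adic valuation of `y`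
(Mathlib's `HeightOneSpectrum.valuation`, with values `exp(n) ∈ ℤᵐ⁰`) is `exp(−ord_v y)` with
`ord_v y = count K v (y)` the exponent of `v` in the fractional ideal `(y)`. [folklore] -/
theorem valuation_eq_exp_neg_count (v : HeightOneSpectrum (𝓞 K)) {y : K} (hy : y ≠ 0) :
    v.valuation K y = WithZero.exp (-FractionalIdeal.count K v (FractionalIdeal.spanSingleton (𝓞 K)⁰ y)) := by
  obtain ⟨a, b, hb, rfl⟩ := IsFractionRing.div_surjective (A := 𝓞 K) y
  have hb0 : b ≠ 0 := nonZeroDivisors.ne_zero hb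
  have hbK : (algebraMap (𝓞 K) K b) ≠ 0 :=
    fun h ↦ hb0 ((IsFractionRing.injective (𝓞 K) K) (by rw [h, map_zero]))
  have ha : a ≠ 0 := by
    rintro rfl
    rw [map_zero, zero_div] at hy
    exact hy rfl
  have haK : (algebraMap (𝓞 K) K a) ≠ 0 :=
    fun h ↦ ha ((IsFractionRing.injective (𝓞 K) K) (by rw [h, map_zero]))
  have hsa : (Ideal.span {a} : Ideal (𝓞 K)) ≠ 0 := by
    rw [Ne, Ideal.zero_eq_bot, Ideal.span_singleton_eq_bot]; exact ha
  have hsb : (Ideal.span {b} : Ideal (𝓞 K)) ≠ 0 := by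
    rw [Ne, Ideal.zero_eq_bot, Ideal.span_singleton_eq_bot]; exact hb0
  rw [map_div₀, valuation_of_algebraMap, valuation_of_algebraMap, intValuation_if_neg _ ha,
    intValuation_if_neg _ hb0, ← WithZero.exp_sub]
  congr 1
  have hab : FractionalIdeal.spanSingleton (𝓞 K)⁰ (algebraMap (𝓞 K) K a / algebraMap (𝓞 K) K b) =
      ((Ideal.span {a} : Ideal (𝓞 K)) : FractionalIdeal (𝓞 K)⁰ K) *
        ((Ideal.span {b} : Ideal (𝓞 K)) : FractionalIdeal (𝓞 K)⁰ K)⁻¹ := by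
    rw [FractionalIdeal.coeIdeal_span_singleton, FractionalIdeal.coeIdeal_span_singleton,
      FractionalIdeal.spanSingleton_inv, div_eq_mul_inv, FractionalIdeal.spanSingleton_mul_spanSingleton]
  have hIa : ((Ideal.span {a} : Ideal (𝓞 K)) : FractionalIdeal (𝓞 K)⁰ K) ≠ 0 :=
    FractionalIdeal.coeIdeal_ne_zero.mpr hsa
  have hIb : ((Ideal.span {b} : Ideal (𝓞 K)) : FractionalIdeal (𝓞 K)⁰ K)⁻¹ ≠ 0 :=
    inv_ne_zero (FractionalIdeal.coeIdeal_ne_zero.mpr hsb)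
  rw [hab, FractionalIdeal.count_mul K v hIa hIb, FractionalIdeal.count_inv,
    FractionalIdeal.count_coe K v hsa, FractionalIdeal.count_coe K v hsb]
  ring

/-- `ord_v y ≥ 0 ⟺ |y|_v ≤ 1` (`y ≠ 0`). [folklore] -/
theorem count_nonneg_iff_valuation_le_one (v : HeightOneSpectrum (𝓞 K)) {y : K} (hy : y ≠ 0) :
    0 ≤ FractionalIdeal.count K v (FractionalIdeal.spanSingleton (𝓞 K)⁰ y) ↔ v.valuation K y ≤ 1 := by
  rw [valuation_eq_exp_neg_count v hy, ← WithZero.exp_zero, WithZero.exp_le_exp, neg_nonpos]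

/-- **A valuation subring of `ℂ` above `v` along `σ`** (Chevalley): for a maximal ideal `v` of `𝓞_K`
and an embedding `σ : K → ℂ` there is a valuation subring `A ⊆ ℂ` with
`σ(y) ∈ A ⟺ |y|_v ≤ 1` for all `y ∈ K` — a valuation ring of `ℂ` dominating the image of the
local ring `𝓞_{K,v}` (Mathlib `IsLocalRing.exists_factor_valuationRing`); for `|y|_v > 1`,
`y⁻¹` is a non-unit of `𝓞_{K,v}`, hence `σ(y)⁻¹` a non-unit of `A`, so `σ(y) ∉ A`. [folklore] -/
theorem exists_valuationSubring_map_mem_iff (v : HeightOneSpectrum (𝓞 K)) (σ : K →+* ℂ) :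
    ∃ A : ValuationSubring ℂ, ∀ y : K, σ y ∈ A ↔ v.valuation K y ≤ 1 := by
  set Rv : ValuationSubring K := valuationSubringAtPrime K v with hRv
  have hmem : ∀ y : K, y ∈ Rv ↔ v.valuation K y ≤ 1 := fun y ↦ by
    rw [hRv, valuationSubringAtPrime_eq_valuationSubring]
    exact Valuation.mem_valuationSubring_iff _ _
  set f : Rv →+* ℂ := σ.comp Rv.subtype with hf
  obtain ⟨A, hA, hloc⟩ := IsLocalRing.exists_factor_valuationRing f
  refine ⟨A, fun y ↦ ⟨fun hy ↦ ?_, fun hy ↦ hA ⟨y, (hmem y).mpr hy⟩⟩⟩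
  by_contra hv
  have hy' : y ∉ Rv := fun h ↦ hv ((hmem y).mp h)
  obtain ⟨hy0, hz, hzn⟩ := PeriodPair.inv_mem_nonunits_of_not_mem hy'
  have h1 : ¬ IsUnit (f.codRestrict A.toSubring hA ⟨y⁻¹, hz⟩) :=
    fun hu ↦ hzn (hloc.map_nonunit _ hu)
  apply h1
  refine IsUnit.of_mul_eq_one ⟨σ y, hy⟩ (Subtype.ext ?_)
  change σ (y⁻¹ : K) * σ y = 1
  rw [← map_mul, inv_mul_cancel₀ hy0, map_one]

end Literature.NumberTheory.DiophantineGeometry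

/-! ### The lattice of the invariant differential: `Δ(Λ) = Δ_W`, `g₂(Λ) = c₄/12` -/

namespace PeriodPair

/-- A period pair with `g₂ = c₄(W)/12`, `g₃ = c₆(W)/216` has `g₂³ − 27g₃² = Δ(W)`
(Silverman AEC III.1: `1728Δ = c₄³ − c₆²`). [cite: SilvermanAEC2009, III.1 and Prop VI.3.6] -/
theorem discr_eq_Δ_of_g₂_g₃ {W : WeierstrassCurve ℂ} {L : PeriodPair} (h₂ : L.g₂ = W.c₄ / 12)
    (h₃ : L.g₃ = W.c₆ / 216) : L.g₂ ^ 3 - 27 * L.g₃ ^ 2 = W.Δ := by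
  rw [h₂, h₃]
  linear_combination (1 / 1728 : ℂ) * W.c_relation.symm

end PeriodPair

/-! ### The finite part (D_v) and the proof of the named fact -/

namespace WeierstrassCurve

open NumberField IsDedekindDomain IsDedekindDomain.HeightOneSpectrum
  Literature.NumberTheory.DiophantineGeometry Literature.NumberTheory.EllipticCurves

/-- **Faltings' isogeny inequality for elliptic curves** (Faltings 1983, §3, Lemma 5, for elliptic
curves; Gaudron–Rémond 2014, §2.3: "si `φ : A → A'` est une isogénie alors
`h(A') ≤ h(A) + ½ log deg φ`"): `h_F(E') ≤ h_F(E) + ½ log deg φ` for every isogeny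
`φ : E → E'` of elliptic curves over a number field — the proof of the named fact
`WeierstrassCurve.stableFaltingsHeight_le_of_isogeny`.  The archimedean part, the global
bookkeeping and the reduction to the per-prime statement (D_v) are
`stableFaltingsHeight_le_of_isogeny_of_localPart`; (D_v) is proved here from the dichotomy
`PeriodPair.valuationSubring_dichotomy_of_le` for the Néron lattices `σ(α₀)Λ_E ⊆ Λ_{E'}` at one
complex embedding and a valuation subring of `ℂ` above `v` (`exists_valuationSubring_map_mem_iff`).
[cite: Faltings1986FinitenessTranslation, §3 Lemma 5; GaudronRemondPeriodes2014, §2.3] -/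
theorem stableFaltingsHeight_le_of_isogeny_holds : stableFaltingsHeight_le_of_isogeny := by
  refine stableFaltingsHeight_le_of_isogeny_of_localPart ?_
  intro K _ _ E E' _ _ ψ α₀ h₁ h₂ h₃ h₁' h₂' h₃' hα₀ hcoord v
  classical
  -- Step 1: `α₀` is the multiplier: lattice inclusion at an embedding
  obtain ⟨α₁, -, hcoord₁, hlat⟩ := ψ.exists_multiplier_of_isShort h₁ h₂ h₃ h₁' h₂' h₃'
  have hαeq : α₁ = α₀ := ψ.multiplier_unique h₁' h₃' hcoord₁ hcoord
  subst hαeq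
  have hσ : Nonempty (K →+* ℂ) := by
    rw [← Fintype.card_pos_iff, NumberField.Embeddings.card K ℂ]
    exact Module.finrank_pos
  obtain ⟨σ⟩ := hσ
  obtain ⟨L, hLg₂, hLg₃⟩ := (E.map σ).exists_periodPair_of_isElliptic'
  obtain ⟨L', hL'g₂, hL'g₃⟩ := (E'.map σ).exists_periodPair_of_isElliptic'
  obtain ⟨hσα, hle, -⟩ := hlat σ L L' hLg₂ hLg₃ hL'g₂ hL'g₃
  -- Step 2: a valuation subring of `ℂ` above `v`
  obtain ⟨A, hA⟩ := exists_valuationSubring_map_mem_iff v σ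
  -- Step 3: the dichotomy for `M = σ(α₀)Λ_E ⊆ Λ_{E'}`
  have hdich := PeriodPair.valuationSubring_dichotomy_of_le hle A
  -- the invariants
  have hMj : (L.mulLeft (σ α₁) hσα).j = σ E.j := by
    rw [PeriodPair.j_mulLeft, PeriodPair.j_eq_weierstrassCurve_j hLg₂ hLg₃, map_j]
  have hL'j : L'.j = σ E'.j := by
    rw [PeriodPair.j_eq_weierstrassCurve_j hL'g₂ hL'g₃, map_j]
  have hΔE : E.Δ ≠ 0 := E.isUnit_Δ.ne_zero
  have hΔE' : E'.Δ ≠ 0 := E'.isUnit_Δ.ne_zero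
  have hμ : (L'.g₂ ^ 3 - 27 * L'.g₃ ^ 2) / ((L.mulLeft (σ α₁) hσα).g₂ ^ 3 - 27 * (L.mulLeft (σ α₁) hσα).g₃ ^ 2) =
      σ (E'.Δ * α₁ ^ 12 / E.Δ) := by
    rw [PeriodPair.discr_mulLeft, PeriodPair.discr_eq_Δ_of_g₂_g₃ hLg₂ hLg₃,
      PeriodPair.discr_eq_Δ_of_g₂_g₃ hL'g₂ hL'g₃, map_Δ, map_Δ, map_div₀, map_mul, map_pow]
    have hσΔ : σ E.Δ ≠ 0 := (map_ne_zero σ).mpr hΔE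
    field_simp
  have hν : L'.g₂ ^ 3 / (L.mulLeft (σ α₁) hσα).g₂ ^ 3 = σ (E'.c₄ ^ 3 * α₁ ^ 12 / E.c₄ ^ 3) := by
    rw [PeriodPair.g₂_mulLeft, hLg₂, hL'g₂, map_c₄, map_c₄, map_div₀, map_mul, map_pow, map_pow, map_pow]
    by_cases hc : σ E.c₄ = 0
    · rw [hc]; simp
    · field_simp
  -- abbreviations for the counts
  set ordj : ℤ := FractionalIdeal.count K v (FractionalIdeal.spanSingleton (𝓞 K)⁰ E.j) with hordj
  set ordj' : ℤ := FractionalIdeal.count K v (FractionalIdeal.spanSingleton (𝓞 K)⁰ E'.j) with hordj'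
  set ordμ : ℤ := FractionalIdeal.count K v (FractionalIdeal.spanSingleton (𝓞 K)⁰ (E'.Δ * α₁ ^ 12 / E.Δ)) with hordμ
  have hμ0 : E'.Δ * α₁ ^ 12 / E.Δ ≠ 0 := div_ne_zero (mul_ne_zero hΔE' (pow_ne_zero _ hα₀)) hΔE
  change max 0 (-ordj') ≤ max 0 (-ordj) + ordμ
  by_cases hj' : v.valuation K E'.j ≤ 1
  · -- `ord_v j' ≥ 0`: then `ord_v μ ≥ 0`
    have h1 : max 0 (-ordj') = 0 := by
      by_cases hj'0 : E'.j = 0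
      · rw [hordj', hj'0, FractionalIdeal.spanSingleton_zero, FractionalIdeal.count_zero]; simp
      · have := (count_nonneg_iff_valuation_le_one v hj'0).mpr hj'
        exact max_eq_left (by linarith)
    have hjA : L'.j ∈ A := by rw [hL'j]; exact (hA _).mpr hj'
    obtain ⟨-, hμA⟩ := hdich.1 hjA
    rw [hμ] at hμA
    have h2 : 0 ≤ ordμ := (count_nonneg_iff_valuation_le_one v hμ0).mpr ((hA _).mp hμA)
    rw [h1]
    have h3 := le_max_left (0 : ℤ) (-ordj)
    linarith
  · -- `ord_v j' < 0`: then `ord_v j < 0` and `ord_v ν ≥ 0`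
    have hj'A : L'.j ∉ A := by rw [hL'j]; exact fun h ↦ hj' ((hA _).mp h)
    obtain ⟨hjA, hνA⟩ := hdich.2 hj'A
    rw [hMj] at hjA
    rw [hν] at hνA
    have hj'0 : E'.j ≠ 0 := by
      rintro h; apply hj'; rw [h, map_zero]; exact zero_le_one
    have hj0 : E.j ≠ 0 := by
      rintro h; apply hjA; rw [h, map_zero]; exact zero_mem A
    have hvj : ¬ v.valuation K E.j ≤ 1 := fun h ↦ hjA ((hA _).mpr h)
    have hc₄ : E.c₄ ≠ 0 := by
      intro h; apply hj0; rw [WeierstrassCurve.j, h]; simp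
    have hc₄' : E'.c₄ ≠ 0 := by
      intro h; apply hj'0; rw [WeierstrassCurve.j, h]; simp
    have hν0 : E'.c₄ ^ 3 * α₁ ^ 12 / E.c₄ ^ 3 ≠ 0 :=
      div_ne_zero (mul_ne_zero (pow_ne_zero _ hc₄') (pow_ne_zero _ hα₀)) (pow_ne_zero _ hc₄)
    have hνcount : 0 ≤ FractionalIdeal.count K v
        (FractionalIdeal.spanSingleton (𝓞 K)⁰ (E'.c₄ ^ 3 * α₁ ^ 12 / E.c₄ ^ 3)) :=
      (count_nonneg_iff_valuation_le_one v hν0).mpr ((hA _).mp hνA)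
    -- `ν = μ · j' / j`
    have hνμ : E'.c₄ ^ 3 * α₁ ^ 12 / E.c₄ ^ 3 = (E'.Δ * α₁ ^ 12 / E.Δ) * E'.j / E.j := by
      rw [WeierstrassCurve.j, WeierstrassCurve.j, Units.val_inv_eq_inv_val, Units.val_inv_eq_inv_val,
        coe_Δ', coe_Δ']
      field_simp
    have hcount : FractionalIdeal.count K v
        (FractionalIdeal.spanSingleton (𝓞 K)⁰ (E'.c₄ ^ 3 * α₁ ^ 12 / E.c₄ ^ 3)) = ordμ + ordj' - ordj := by
      rw [hνμ, div_eq_mul_inv, ← FractionalIdeal.spanSingleton_mul_spanSingleton,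
        ← FractionalIdeal.spanSingleton_mul_spanSingleton, ← FractionalIdeal.spanSingleton_inv,
        FractionalIdeal.count_mul K v, FractionalIdeal.count_mul K v, FractionalIdeal.count_inv]
      · ring
      · exact (FractionalIdeal.spanSingleton_eq_zero_iff).not.mpr hμ0
      · exact (FractionalIdeal.spanSingleton_eq_zero_iff).not.mpr hj'0
      · exact mul_ne_zero ((FractionalIdeal.spanSingleton_eq_zero_iff).not.mpr hμ0)
          ((FractionalIdeal.spanSingleton_eq_zero_iff).not.mpr hj'0)
      · exact inv_ne_zero ((FractionalIdeal.spanSingleton_eq_zero_iff).not.mpr hj0)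
    have hordj : ordj < 0 := by
      by_contra h
      exact hvj ((count_nonneg_iff_valuation_le_one v hj0).mp (not_lt.mp h))
    have hordj' : ordj' < 0 := by
      by_contra h
      exact hj' ((count_nonneg_iff_valuation_le_one v hj'0).mp (not_lt.mp h))
    rw [max_eq_right (by linarith), max_eq_right (by linarith)]
    rw [hcount] at hνcount
    linarith

end WeierstrassCurve


end FinitePart

end
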